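import Summits.Ventures.CertifiedManyBodySolver.Downfold.EmeryOrbitalWeightAxisBox
import Summits.Ventures.CertifiedManyBodySolver.Downfold.EmeryScaleBoxLa214DFTX0125Pts
import Summits.Ventures.CertifiedManyBodySolver.Downfold.EmeryScaleBoxLa214DFTX022Pts
import Summits.Ventures.CertifiedManyBodySolver.Downfold.EmeryScaleBoxLa214DFTX0Pts
import Summits.Ventures.CertifiedManyBodySolver.Downfold.EmeryScaleBoxLa214SOLX0125Pts
import Summits.Ventures.CertifiedManyBodySolver.Downfold.EmeryScaleBoxLa214SOLX022Pts
import Summits.Ventures.CertifiedManyBodySolver.Downfold.EmeryScaleBoxLa214SOLX0Pts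
import Summits.Ventures.CertifiedManyBodySolver.Downfold.EmeryScaleBoxLa214X0125Pts
import Summits.Ventures.CertifiedManyBodySolver.Downfold.EmeryScaleBoxLa214X022Pts
import Summits.Ventures.CertifiedManyBodySolver.Downfold.EmeryScaleBoxLa214X0Pts
import HarnessLib

/-!
# THE UNIVERSAL FERMI-SURFACE Cu-d WEIGHT CEILING OVER THE TYPED La₂CuO₄ box #18 (`emeryBoxLa214v123`) and its two Δ_pd level-tag sub-boxes — every Bloch state of every member's Fermi
# surface, at every filling of record, whatever the Fermi-surface topology (INFL-3to1-B §B.90 (c); kernel `EmeryOrbitalWeightAxisBox`; router/OBJECT-E-BUDGET.tsv §C)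

Venture CertifiedManyBodySolver, cell `pub/hubbard-downfold` (stage S1), seat hubbard-downfold-mod-4 (technique B, g38); namespace
`Summit.Ventures.CertifiedManyBodySolver.Downfold.Emery`. Everything PROVED (0 sorry). WHAT THIS IS NOT: a statement about the material — the typed boxes are SCREENING-GRADE;
`U = 0` one-body kinematics of the σ model; the `U_B∣full` ceiling that consumes it is DERIVED context on the MEAN-FIELD annex (R-B17).

DEVICE: `w_d(k) ≤ w_axis(ε_F)` at every zone Fermi point (`EmeryOrbitalWeightAxis`), `w_axis` ↓ in ε under the two-energy margin and ↑ in Δ, ↓ in t_pd, ↑ in t_pp′ at fixed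
energy ⇒ ONE corner `dWeightAxisCF(Δ₂, a₁, c₂; E_l)` bounds the whole box, `E_l` = the landed lower Fermi-energy bracket at `(Δ₂, a₁, b₁, c₂)` (`EmeryScaleBox<Tag><X>Pts`).
The ceiling is LOOSER than the antinodal window of `EmeryBoxes<Tag>FaceWeight<X>` (which needs a hole-like Fermi surface and the antinodal charge-transfer regime) by the gap
`w_axis − w_face`, but it holds at fillings beyond the box's van Hove window (x = 0.22 on box #18) and on boxes outside the regime (box #19).

| box (Δ tag) | filling | ceiling corner (Δ₂, a₁, c₂; E_l) | **w_d ≤** |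
|---|---|---|---|
| La214ALL | x0 (ν = 1/2) | (4, 1.29, 0.15; E_l = 1.2489) | **0.8257** |
| La214ALL | x0125 (ν = 7/16) | (4, 1.29, 0.15; E_l = 1.1653) | **0.8321** |
| La214ALL | x022 (ν = 39/100) | (4, 1.29, 0.15; E_l = 1.118) | **0.8359** |
| La214DFT | x0 (ν = 1/2) | (2.91, 1.29, 0.15; E_l = 1.4953) | **0.773** |
| La214DFT | x0125 (ν = 7/16) | (2.91, 1.29, 0.15; E_l = 1.3928) | **0.7794** |
| La214DFT | x022 (ν = 39/100) | (2.91, 1.29, 0.15; E_l = 1.3389) | **0.7831** |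
| La214SOL | x0 (ν = 1/2) | (4, 1.29, 0.15; E_l = 1.2489) | **0.8257** |
| La214SOL | x0125 (ν = 7/16) | (4, 1.29, 0.15; E_l = 1.1653) | **0.8321** |
| La214SOL | x022 (ν = 39/100) | (4, 1.29, 0.15; E_l = 1.118) | **0.8359** |

Sources: three-band model [HybertsenSchluterChristensen1989, Eq. (1)]; two-level axis decoupling [AndersenEtAl1995, §6]; [folklore] algebra.
-/

noncomputable section

namespace Summit.Ventures.CertifiedManyBodySolver.Downfold.Emery

open Real Set

/-- **`emeryBoxLa214v123`, x = 0 (ν = 1/2): EVERY Fermi-surface Bloch state of EVERY member has Cu-d weight `≤ 0.8257`** — the axis-weight ceiling at the corner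
`(Δ₂, a₁, c₂) = (4, 1.29, 0.15)` and the box's bottom Fermi energy `E_l = 1.2489` (brackets `scalePt_La214X0_FL_br` / `scalePt_La214X0_TP_br`); any Fermi-surface topology. [folklore] -/
theorem la214ALLBox_dWeightFS_le_x0 {Δ a b c x y : ℝ} (hΔ : Δ ∈ Icc ((17 : ℝ) / 10) (4 : ℝ)) (ha : a ∈ Icc ((129 : ℝ) / 100) ((38 : ℝ) / 25)) (hb : b ∈ Icc ((23 : ℝ) / 50) ((33 : ℝ) / 50))
    (hc : c ∈ Icc ((3 : ℝ) / 25) ((3 : ℝ) / 20)) (hx : x ∈ Icc (0 : ℝ) 1) (hy : y ∈ Icc (0 : ℝ) 1)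
    (hP : charCubic Δ a b c x y (fermiEnergyOf Δ a b c ((1 : ℝ) / 2)) = 0) :
    dWeight Δ a b c x y (fermiEnergyOf Δ a b c ((1 : ℝ) / 2)) ≤ ((8257 : ℝ) / 10000) := by
  have hF := (fermiEnergyOf_of_pointBracketCheck scalePt_La214X0_FL_br (by norm_num) (by norm_num) (by norm_num) (ν := (1/2 : ℝ))
    (by push_cast; exact ⟨le_rfl, le_rfl⟩)).2
  have hT := (fermiEnergyOf_of_pointBracketCheck scalePt_La214X0_TP_br (by norm_num) (by norm_num) (by norm_num) (ν := (1/2 : ℝ))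
    (by push_cast; exact ⟨le_rfl, le_rfl⟩)).2
  push_cast at hF hT
  exact dWeight_le_of_mem_box_axis' (El := ((12489 : ℝ) / 10000)) (Eh := ((487 : ℝ) / 200)) (by norm_num) (by norm_num) (by norm_num) (by norm_num) (by norm_num) hΔ ha hb hc
    (by norm_num) (by norm_num) (by norm_num) hF.1 hT.2 (by norm_num) (by norm_num) (by norm_num) (by norm_num [dWeightAxisCF]) hx hy hP

/-- **`emeryBoxLa214v123`, x = 1/8 (ν = 7/16): EVERY Fermi-surface Bloch state of EVERY member has Cu-d weight `≤ 0.8321`** — the axis-weight ceiling at the corner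
`(Δ₂, a₁, c₂) = (4, 1.29, 0.15)` and the box's bottom Fermi energy `E_l = 1.1653` (brackets `scalePt_La214X0125_FL_br` / `scalePt_La214X0125_TP_br`); any Fermi-surface topology. [folklore] -/
theorem la214ALLBox_dWeightFS_le_x0125 {Δ a b c x y : ℝ} (hΔ : Δ ∈ Icc ((17 : ℝ) / 10) (4 : ℝ)) (ha : a ∈ Icc ((129 : ℝ) / 100) ((38 : ℝ) / 25)) (hb : b ∈ Icc ((23 : ℝ) / 50) ((33 : ℝ) / 50))
    (hc : c ∈ Icc ((3 : ℝ) / 25) ((3 : ℝ) / 20)) (hx : x ∈ Icc (0 : ℝ) 1) (hy : y ∈ Icc (0 : ℝ) 1)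
    (hP : charCubic Δ a b c x y (fermiEnergyOf Δ a b c ((7 : ℝ) / 16)) = 0) :
    dWeight Δ a b c x y (fermiEnergyOf Δ a b c ((7 : ℝ) / 16)) ≤ ((8321 : ℝ) / 10000) := by
  have hF := (fermiEnergyOf_of_pointBracketCheck scalePt_La214X0125_FL_br (by norm_num) (by norm_num) (by norm_num) (ν := (7/16 : ℝ))
    (by push_cast; exact ⟨le_rfl, le_rfl⟩)).2
  have hT := (fermiEnergyOf_of_pointBracketCheck scalePt_La214X0125_TP_br (by norm_num) (by norm_num) (by norm_num) (ν := (7/16 : ℝ))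
    (by push_cast; exact ⟨le_rfl, le_rfl⟩)).2
  push_cast at hF hT
  exact dWeight_le_of_mem_box_axis' (El := ((11653 : ℝ) / 10000)) (Eh := ((2827 : ℝ) / 1250)) (by norm_num) (by norm_num) (by norm_num) (by norm_num) (by norm_num) hΔ ha hb hc
    (by norm_num) (by norm_num) (by norm_num) hF.1 hT.2 (by norm_num) (by norm_num) (by norm_num) (by norm_num [dWeightAxisCF]) hx hy hP

/-- **`emeryBoxLa214v123`, x = 0.22 (ν = 39/100): EVERY Fermi-surface Bloch state of EVERY member has Cu-d weight `≤ 0.8359`** — the axis-weight ceiling at the corner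
`(Δ₂, a₁, c₂) = (4, 1.29, 0.15)` and the box's bottom Fermi energy `E_l = 1.118` (brackets `scalePt_La214X022_FL_br` / `scalePt_La214X022_TP_br`); any Fermi-surface topology. [folklore] -/
theorem la214ALLBox_dWeightFS_le_x022 {Δ a b c x y : ℝ} (hΔ : Δ ∈ Icc ((17 : ℝ) / 10) (4 : ℝ)) (ha : a ∈ Icc ((129 : ℝ) / 100) ((38 : ℝ) / 25)) (hb : b ∈ Icc ((23 : ℝ) / 50) ((33 : ℝ) / 50))
    (hc : c ∈ Icc ((3 : ℝ) / 25) ((3 : ℝ) / 20)) (hx : x ∈ Icc (0 : ℝ) 1) (hy : y ∈ Icc (0 : ℝ) 1)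
    (hP : charCubic Δ a b c x y (fermiEnergyOf Δ a b c ((39 : ℝ) / 100)) = 0) :
    dWeight Δ a b c x y (fermiEnergyOf Δ a b c ((39 : ℝ) / 100)) ≤ ((8359 : ℝ) / 10000) := by
  have hF := (fermiEnergyOf_of_pointBracketCheck scalePt_La214X022_FL_br (by norm_num) (by norm_num) (by norm_num) (ν := (39/100 : ℝ))
    (by push_cast; exact ⟨le_rfl, le_rfl⟩)).2
  have hT := (fermiEnergyOf_of_pointBracketCheck scalePt_La214X022_TP_br (by norm_num) (by norm_num) (by norm_num) (ν := (39/100 : ℝ))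
    (by push_cast; exact ⟨le_rfl, le_rfl⟩)).2
  push_cast at hF hT
  exact dWeight_le_of_mem_box_axis' (El := ((559 : ℝ) / 500)) (Eh := ((21567 : ℝ) / 10000)) (by norm_num) (by norm_num) (by norm_num) (by norm_num) (by norm_num) hΔ ha hb hc
    (by norm_num) (by norm_num) (by norm_num) hF.1 hT.2 (by norm_num) (by norm_num) (by norm_num) (by norm_num [dWeightAxisCF]) hx hy hP

/-- **`emeryBoxLa214v123 ∩ {Δ_pd ∈ [1.7, 2.91]} (DFT-level Δ tag)`, x = 0 (ν = 1/2): EVERY Fermi-surface Bloch state of EVERY member has Cu-d weight `≤ 0.773`** — the axis-weight ceiling at the corner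
`(Δ₂, a₁, c₂) = (2.91, 1.29, 0.15)` and the box's bottom Fermi energy `E_l = 1.4953` (brackets `scalePt_La214DFTX0_FL_br` / `scalePt_La214DFTX0_TP_br`); any Fermi-surface topology. [folklore] -/
theorem la214DFTBox_dWeightFS_le_x0 {Δ a b c x y : ℝ} (hΔ : Δ ∈ Icc ((17 : ℝ) / 10) ((291 : ℝ) / 100)) (ha : a ∈ Icc ((129 : ℝ) / 100) ((38 : ℝ) / 25)) (hb : b ∈ Icc ((23 : ℝ) / 50) ((33 : ℝ) / 50))
    (hc : c ∈ Icc ((3 : ℝ) / 25) ((3 : ℝ) / 20)) (hx : x ∈ Icc (0 : ℝ) 1) (hy : y ∈ Icc (0 : ℝ) 1)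
    (hP : charCubic Δ a b c x y (fermiEnergyOf Δ a b c ((1 : ℝ) / 2)) = 0) :
    dWeight Δ a b c x y (fermiEnergyOf Δ a b c ((1 : ℝ) / 2)) ≤ ((773 : ℝ) / 1000) := by
  have hF := (fermiEnergyOf_of_pointBracketCheck scalePt_La214DFTX0_FL_br (by norm_num) (by norm_num) (by norm_num) (ν := (1/2 : ℝ))
    (by push_cast; exact ⟨le_rfl, le_rfl⟩)).2
  have hT := (fermiEnergyOf_of_pointBracketCheck scalePt_La214DFTX0_TP_br (by norm_num) (by norm_num) (by norm_num) (ν := (1/2 : ℝ))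
    (by push_cast; exact ⟨le_rfl, le_rfl⟩)).2
  push_cast at hF hT
  exact dWeight_le_of_mem_box_axis' (El := ((14953 : ℝ) / 10000)) (Eh := ((487 : ℝ) / 200)) (by norm_num) (by norm_num) (by norm_num) (by norm_num) (by norm_num) hΔ ha hb hc
    (by norm_num) (by norm_num) (by norm_num) hF.1 hT.2 (by norm_num) (by norm_num) (by norm_num) (by norm_num [dWeightAxisCF]) hx hy hP

/-- **`emeryBoxLa214v123 ∩ {Δ_pd ∈ [1.7, 2.91]} (DFT-level Δ tag)`, x = 1/8 (ν = 7/16): EVERY Fermi-surface Bloch state of EVERY member has Cu-d weight `≤ 0.7794`** — the axis-weight ceiling at the corner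
`(Δ₂, a₁, c₂) = (2.91, 1.29, 0.15)` and the box's bottom Fermi energy `E_l = 1.3928` (brackets `scalePt_La214DFTX0125_FL_br` / `scalePt_La214DFTX0125_TP_br`); any Fermi-surface topology. [folklore] -/
theorem la214DFTBox_dWeightFS_le_x0125 {Δ a b c x y : ℝ} (hΔ : Δ ∈ Icc ((17 : ℝ) / 10) ((291 : ℝ) / 100)) (ha : a ∈ Icc ((129 : ℝ) / 100) ((38 : ℝ) / 25)) (hb : b ∈ Icc ((23 : ℝ) / 50) ((33 : ℝ) / 50))
    (hc : c ∈ Icc ((3 : ℝ) / 25) ((3 : ℝ) / 20)) (hx : x ∈ Icc (0 : ℝ) 1) (hy : y ∈ Icc (0 : ℝ) 1)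
    (hP : charCubic Δ a b c x y (fermiEnergyOf Δ a b c ((7 : ℝ) / 16)) = 0) :
    dWeight Δ a b c x y (fermiEnergyOf Δ a b c ((7 : ℝ) / 16)) ≤ ((3897 : ℝ) / 5000) := by
  have hF := (fermiEnergyOf_of_pointBracketCheck scalePt_La214DFTX0125_FL_br (by norm_num) (by norm_num) (by norm_num) (ν := (7/16 : ℝ))
    (by push_cast; exact ⟨le_rfl, le_rfl⟩)).2
  have hT := (fermiEnergyOf_of_pointBracketCheck scalePt_La214DFTX0125_TP_br (by norm_num) (by norm_num) (by norm_num) (ν := (7/16 : ℝ))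
    (by push_cast; exact ⟨le_rfl, le_rfl⟩)).2
  push_cast at hF hT
  exact dWeight_le_of_mem_box_axis' (El := ((1741 : ℝ) / 1250)) (Eh := ((2827 : ℝ) / 1250)) (by norm_num) (by norm_num) (by norm_num) (by norm_num) (by norm_num) hΔ ha hb hc
    (by norm_num) (by norm_num) (by norm_num) hF.1 hT.2 (by norm_num) (by norm_num) (by norm_num) (by norm_num [dWeightAxisCF]) hx hy hP

/-- **`emeryBoxLa214v123 ∩ {Δ_pd ∈ [1.7, 2.91]} (DFT-level Δ tag)`, x = 0.22 (ν = 39/100): EVERY Fermi-surface Bloch state of EVERY member has Cu-d weight `≤ 0.7831`** — the axis-weight ceiling at the corner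
`(Δ₂, a₁, c₂) = (2.91, 1.29, 0.15)` and the box's bottom Fermi energy `E_l = 1.3389` (brackets `scalePt_La214DFTX022_FL_br` / `scalePt_La214DFTX022_TP_br`); any Fermi-surface topology. [folklore] -/
theorem la214DFTBox_dWeightFS_le_x022 {Δ a b c x y : ℝ} (hΔ : Δ ∈ Icc ((17 : ℝ) / 10) ((291 : ℝ) / 100)) (ha : a ∈ Icc ((129 : ℝ) / 100) ((38 : ℝ) / 25)) (hb : b ∈ Icc ((23 : ℝ) / 50) ((33 : ℝ) / 50))
    (hc : c ∈ Icc ((3 : ℝ) / 25) ((3 : ℝ) / 20)) (hx : x ∈ Icc (0 : ℝ) 1) (hy : y ∈ Icc (0 : ℝ) 1)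
    (hP : charCubic Δ a b c x y (fermiEnergyOf Δ a b c ((39 : ℝ) / 100)) = 0) :
    dWeight Δ a b c x y (fermiEnergyOf Δ a b c ((39 : ℝ) / 100)) ≤ ((7831 : ℝ) / 10000) := by
  have hF := (fermiEnergyOf_of_pointBracketCheck scalePt_La214DFTX022_FL_br (by norm_num) (by norm_num) (by norm_num) (ν := (39/100 : ℝ))
    (by push_cast; exact ⟨le_rfl, le_rfl⟩)).2
  have hT := (fermiEnergyOf_of_pointBracketCheck scalePt_La214DFTX022_TP_br (by norm_num) (by norm_num) (by norm_num) (ν := (39/100 : ℝ))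
    (by push_cast; exact ⟨le_rfl, le_rfl⟩)).2
  push_cast at hF hT
  exact dWeight_le_of_mem_box_axis' (El := ((13389 : ℝ) / 10000)) (Eh := ((21567 : ℝ) / 10000)) (by norm_num) (by norm_num) (by norm_num) (by norm_num) (by norm_num) hΔ ha hb hc
    (by norm_num) (by norm_num) (by norm_num) hF.1 hT.2 (by norm_num) (by norm_num) (by norm_num) (by norm_num [dWeightAxisCF]) hx hy hP

/-- **`emeryBoxLa214v123 ∩ {Δ_pd ∈ [3.24, 4.0]} (solver-level Δ tag)`, x = 0 (ν = 1/2): EVERY Fermi-surface Bloch state of EVERY member has Cu-d weight `≤ 0.8257`** — the axis-weight ceiling at the corner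
`(Δ₂, a₁, c₂) = (4, 1.29, 0.15)` and the box's bottom Fermi energy `E_l = 1.2489` (brackets `scalePt_La214SOLX0_FL_br` / `scalePt_La214SOLX0_TP_br`); any Fermi-surface topology. [folklore] -/
theorem la214SOLBox_dWeightFS_le_x0 {Δ a b c x y : ℝ} (hΔ : Δ ∈ Icc ((81 : ℝ) / 25) (4 : ℝ)) (ha : a ∈ Icc ((129 : ℝ) / 100) ((38 : ℝ) / 25)) (hb : b ∈ Icc ((23 : ℝ) / 50) ((33 : ℝ) / 50))
    (hc : c ∈ Icc ((3 : ℝ) / 25) ((3 : ℝ) / 20)) (hx : x ∈ Icc (0 : ℝ) 1) (hy : y ∈ Icc (0 : ℝ) 1)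
    (hP : charCubic Δ a b c x y (fermiEnergyOf Δ a b c ((1 : ℝ) / 2)) = 0) :
    dWeight Δ a b c x y (fermiEnergyOf Δ a b c ((1 : ℝ) / 2)) ≤ ((8257 : ℝ) / 10000) := by
  have hF := (fermiEnergyOf_of_pointBracketCheck scalePt_La214SOLX0_FL_br (by norm_num) (by norm_num) (by norm_num) (ν := (1/2 : ℝ))
    (by push_cast; exact ⟨le_rfl, le_rfl⟩)).2
  have hT := (fermiEnergyOf_of_pointBracketCheck scalePt_La214SOLX0_TP_br (by norm_num) (by norm_num) (by norm_num) (ν := (1/2 : ℝ))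
    (by push_cast; exact ⟨le_rfl, le_rfl⟩)).2
  push_cast at hF hT
  exact dWeight_le_of_mem_box_axis' (El := ((12489 : ℝ) / 10000)) (Eh := ((19059 : ℝ) / 10000)) (by norm_num) (by norm_num) (by norm_num) (by norm_num) (by norm_num) hΔ ha hb hc
    (by norm_num) (by norm_num) (by norm_num) hF.1 hT.2 (by norm_num) (by norm_num) (by norm_num) (by norm_num [dWeightAxisCF]) hx hy hP

/-- **`emeryBoxLa214v123 ∩ {Δ_pd ∈ [3.24, 4.0]} (solver-level Δ tag)`, x = 1/8 (ν = 7/16): EVERY Fermi-surface Bloch state of EVERY member has Cu-d weight `≤ 0.8321`** — the axis-weight ceiling at the corner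
`(Δ₂, a₁, c₂) = (4, 1.29, 0.15)` and the box's bottom Fermi energy `E_l = 1.1653` (brackets `scalePt_La214SOLX0125_FL_br` / `scalePt_La214SOLX0125_TP_br`); any Fermi-surface topology. [folklore] -/
theorem la214SOLBox_dWeightFS_le_x0125 {Δ a b c x y : ℝ} (hΔ : Δ ∈ Icc ((81 : ℝ) / 25) (4 : ℝ)) (ha : a ∈ Icc ((129 : ℝ) / 100) ((38 : ℝ) / 25)) (hb : b ∈ Icc ((23 : ℝ) / 50) ((33 : ℝ) / 50))
    (hc : c ∈ Icc ((3 : ℝ) / 25) ((3 : ℝ) / 20)) (hx : x ∈ Icc (0 : ℝ) 1) (hy : y ∈ Icc (0 : ℝ) 1)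
    (hP : charCubic Δ a b c x y (fermiEnergyOf Δ a b c ((7 : ℝ) / 16)) = 0) :
    dWeight Δ a b c x y (fermiEnergyOf Δ a b c ((7 : ℝ) / 16)) ≤ ((8321 : ℝ) / 10000) := by
  have hF := (fermiEnergyOf_of_pointBracketCheck scalePt_La214SOLX0125_FL_br (by norm_num) (by norm_num) (by norm_num) (ν := (7/16 : ℝ))
    (by push_cast; exact ⟨le_rfl, le_rfl⟩)).2
  have hT := (fermiEnergyOf_of_pointBracketCheck scalePt_La214SOLX0125_TP_br (by norm_num) (by norm_num) (by norm_num) (ν := (7/16 : ℝ))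
    (by push_cast; exact ⟨le_rfl, le_rfl⟩)).2
  push_cast at hF hT
  exact dWeight_le_of_mem_box_axis' (El := ((11653 : ℝ) / 10000)) (Eh := ((17651 : ℝ) / 10000)) (by norm_num) (by norm_num) (by norm_num) (by norm_num) (by norm_num) hΔ ha hb hc
    (by norm_num) (by norm_num) (by norm_num) hF.1 hT.2 (by norm_num) (by norm_num) (by norm_num) (by norm_num [dWeightAxisCF]) hx hy hP

/-- **`emeryBoxLa214v123 ∩ {Δ_pd ∈ [3.24, 4.0]} (solver-level Δ tag)`, x = 0.22 (ν = 39/100): EVERY Fermi-surface Bloch state of EVERY member has Cu-d weight `≤ 0.8359`** — the axis-weight ceiling at the corner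
`(Δ₂, a₁, c₂) = (4, 1.29, 0.15)` and the box's bottom Fermi energy `E_l = 1.118` (brackets `scalePt_La214SOLX022_FL_br` / `scalePt_La214SOLX022_TP_br`); any Fermi-surface topology. [folklore] -/
theorem la214SOLBox_dWeightFS_le_x022 {Δ a b c x y : ℝ} (hΔ : Δ ∈ Icc ((81 : ℝ) / 25) (4 : ℝ)) (ha : a ∈ Icc ((129 : ℝ) / 100) ((38 : ℝ) / 25)) (hb : b ∈ Icc ((23 : ℝ) / 50) ((33 : ℝ) / 50))
    (hc : c ∈ Icc ((3 : ℝ) / 25) ((3 : ℝ) / 20)) (hx : x ∈ Icc (0 : ℝ) 1) (hy : y ∈ Icc (0 : ℝ) 1)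
    (hP : charCubic Δ a b c x y (fermiEnergyOf Δ a b c ((39 : ℝ) / 100)) = 0) :
    dWeight Δ a b c x y (fermiEnergyOf Δ a b c ((39 : ℝ) / 100)) ≤ ((8359 : ℝ) / 10000) := by
  have hF := (fermiEnergyOf_of_pointBracketCheck scalePt_La214SOLX022_FL_br (by norm_num) (by norm_num) (by norm_num) (ν := (39/100 : ℝ))
    (by push_cast; exact ⟨le_rfl, le_rfl⟩)).2
  have hT := (fermiEnergyOf_of_pointBracketCheck scalePt_La214SOLX022_TP_br (by norm_num) (by norm_num) (by norm_num) (ν := (39/100 : ℝ))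
    (by push_cast; exact ⟨le_rfl, le_rfl⟩)).2
  push_cast at hF hT
  exact dWeight_le_of_mem_box_axis' (El := ((559 : ℝ) / 500)) (Eh := ((16929 : ℝ) / 10000)) (by norm_num) (by norm_num) (by norm_num) (by norm_num) (by norm_num) hΔ ha hb hc
    (by norm_num) (by norm_num) (by norm_num) hF.1 hT.2 (by norm_num) (by norm_num) (by norm_num) (by norm_num [dWeightAxisCF]) hx hy hP

end Summit.Ventures.CertifiedManyBodySolver.Downfold.Emery
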